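import Summits.SmoothPoincare4.SmoothPoincare4.Theorems.ConvexBisectionAcyclicBisectionExistsHurwitzReduction
import Literature.Topology.FourManifolds.HandleAttachingMapsShrink
import HarnessLib

/-!
# N1-move, piece (a): thin tubes with the same seam — shrinking the attaching maps of a datum
(wave 7, brick of stub `stub_M2geo` = node N1 of NF4 ▸ `node_N1_move` ▸ piece (a) "model
replacement / shrink" of the contract `node_N1_move ⇐ (a) ∧ (c) ∧ (d) ∧ (e)` (`N1_Move_Design.lean`,
H7), line `modp-braid-orbits`, crux `ConvexBisection.AcyclicBisectionExists`, item
stmt-SmoothPoincare4-10508; registered sub-goal `helper_exists_thinData`)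

Before a handle of a fibred datum `(X, h, D)` is dragged through a sector of pages, all tubes
`range (h k).toFun` must be made thin (a fat tube of a third handle may fill the target page up to a
graph, G4's finding (F6)).  Kosinski's locality (`HandleAttachingMapsLocality.lean`: the attached
manifold only depends on `h̄` near the attaching sphere) and the reparametrisation `h̄ ∘ ρ_ε`
(`HandleAttachingMapsShrink.lean`) give this at the level of DATA, keeping everything the seam and
belt clauses of the N1 contract are phrased with:

* §1 `exists_lamSq_gt_mem` — compactness at the attaching sphere: if the core `h̄(S)` lies in an open
  `U`, then `h̄ {|y_λ|² > 1 − 2ε} ⊆ U` for some `0 < ε ≤ 1/4` (uniformly over a finite family,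
  `exists_eps_family`);
* §2 **`exists_thinData`**: for every open `U k ⊇ (h k).core` there are attaching maps `h' k`
  (`= (h k).shrink`) and data `D'` of the SAME `X` with `range (h' k).toFun ⊆ U k`, the same attaching
  circles, handle framings and cores, `D'.jA = D.jA` on the (common) complement of the cores,
  `range D'.jA = range D.jA`, and `D'.jB k = D.jB k` at the deep points (those off `range D'.jA`) — the
  datum `LocalityData.isMultiAttachment` builds, with its `jA`/`jB` trace exported;
* §3 the registered form `helper_exists_thinData`.

(Transport of a datum along a diffeomorphism of the base — the other half of "model replacement" —
is the tree's `MultiAttachmentData.transport` with `transport_jA`, `transport_jB`.)  Everything is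
proved; no definitions, no named facts, no `sorry`.  Reference: A. A. Kosinski, *Differential
Manifolds* (1993), VI §1 (proof of (1.1)) and VI §6 [Kosinski1993].
-/

noncomputable section

set_option linter.dupNamespace false

open scoped Manifold ContDiff Topology
open Set Function Metric

namespace Summit.SmoothPoincare4.SmoothPoincare4.Theorems.AcyclicBisectionExists.ModpBraidOrbits

open Literature.Topology.FourManifolds Literature.Topology.FourManifolds.LefschetzBase
open Literature.Topology.FourManifolds.HandleAttachingMap

namespace HurwitzMoveModel

/-! ## §1 Compactness at the attaching sphere -/

section Compact

variable {n k : ℕ} {M : Type} [TopologicalSpace M] [ChartedSpace (EuclideanHalfSpace (n + 1)) M]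

/-- **A thin tube lies in any neighbourhood of the core**: if `h̄(S) ⊆ U` with `U` open, then for
some `0 < ε ≤ 1/4` every `y ∈ T` with `|y_λ|² > 1 − 2ε` has `h̄ y ∈ U` (the continuous `|y_λ|²`
attains a maximum `< 1` on the compact set `{|y_λ|² ≥ 1/2} ∖ h̄⁻¹ U`). [folklore] -/
theorem exists_lamSq_gt_mem (f : HandleAttachingMap n k M) {U : Set M} (hU : IsOpen U)
    (hcore : f.core ⊆ U) :
    ∃ ε : ℝ, 0 < ε ∧ ε ≤ 1 / 4 ∧ ∀ y : ↥(handleTube n k),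
      1 - 2 * ε < lamSq k (((y : closedBall (0 : EuclideanSpace ℝ (Fin (n + 1))) 1) :
        EuclideanSpace ℝ (Fin (n + 1)))) → f.toFun y ∈ U := by
  set F : ↥(handleTube n k) → ℝ := fun y =>
    lamSq k (((y : closedBall (0 : EuclideanSpace ℝ (Fin (n + 1))) 1) :
      EuclideanSpace ℝ (Fin (n + 1)))) with hF
  have hFc : Continuous F := continuous_lamSq_handleTube n k
  set V : Set ↥(handleTube n k) := f.toFun ⁻¹' U with hV
  have hVo : IsOpen V := hU.preimage f.continuous
  have hSV : ∀ y : ↥(handleTube n k), F y = 1 → y ∈ V := fun y hy =>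
    hcore ⟨y, hy, rfl⟩
  set K : Set ↥(handleTube n k) := {y | (1 / 2 : ℝ) ≤ F y} with hK
  have hemb : Topology.IsEmbedding (fun y : ↥(handleTube n k) =>
      ((y : closedBall (0 : EuclideanSpace ℝ (Fin (n + 1))) 1) : EuclideanSpace ℝ (Fin (n + 1)))) :=
    Topology.IsEmbedding.subtypeVal.comp Topology.IsEmbedding.subtypeVal
  have hKc : IsCompact K := by
    rw [hemb.isCompact_iff]
    have himg : (fun y : ↥(handleTube n k) =>
        ((y : closedBall (0 : EuclideanSpace ℝ (Fin (n + 1))) 1) : EuclideanSpace ℝ (Fin (n + 1)))) '' K =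
        closedBall (0 : EuclideanSpace ℝ (Fin (n + 1))) 1 ∩ {u | (1 / 2 : ℝ) ≤ lamSq k u} := by
      ext u
      constructor
      · rintro ⟨y, hy, rfl⟩
        exact ⟨(y : closedBall (0 : EuclideanSpace ℝ (Fin (n + 1))) 1).2, hy⟩
      · rintro ⟨hu, hu'⟩
        have hu0 : lamSq k u ≠ 0 := by
          intro h0; simp only [mem_setOf_eq, h0] at hu'; linarith
        exact ⟨⟨⟨u, hu⟩, hu0⟩, hu', rfl⟩
    rw [himg]
    exact (isCompact_closedBall _ _).inter_right (isClosed_le continuous_const (continuous_lamSq k))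
  have hCc : IsCompact (K \ V) := hKc.diff hVo
  by_cases hCe : K \ V = ∅
  · refine ⟨1 / 4, by norm_num, le_rfl, fun y hy => ?_⟩
    have hyK : y ∈ K := by show (1 / 2 : ℝ) ≤ F y; change 1 - 2 * (1 / 4) < F y at hy; linarith
    by_contra hyV
    have : y ∈ K \ V := ⟨hyK, hyV⟩
    rw [hCe] at this
    exact this
  · obtain ⟨y₀, hy₀, hmax⟩ := hCc.exists_isMaxOn (nonempty_iff_ne_empty.2 hCe) hFc.continuousOn
    have hF1 : F y₀ < 1 := by
      refine lt_of_le_of_ne (lamSq_le_one (mem_closedBall_zero_iff.1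
        (y₀ : closedBall (0 : EuclideanSpace ℝ (Fin (n + 1))) 1).2)) fun h1 => hy₀.2 (hSV y₀ h1)
    refine ⟨min (1 / 4) ((1 - F y₀) / 2), lt_min (by norm_num) (by linarith), min_le_left _ _,
      fun y hy => ?_⟩
    by_contra hyV
    have hyK : y ∈ K := by
      show (1 / 2 : ℝ) ≤ F y
      have : 1 - 2 * min (1 / 4) ((1 - F y₀) / 2) ≥ 1 / 2 := by
        have := min_le_left (1 / 4 : ℝ) ((1 - F y₀) / 2); linarith
      change 1 - 2 * min (1 / 4) ((1 - F y₀) / 2) < F y at hy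
      linarith
    have hle : F y ≤ F y₀ := hmax ⟨hyK, hyV⟩
    have : 1 - 2 * min (1 / 4) ((1 - F y₀) / 2) ≥ F y₀ := by
      have := min_le_right (1 / 4 : ℝ) ((1 - F y₀) / 2); linarith
    change 1 - 2 * min (1 / 4) ((1 - F y₀) / 2) < F y at hy
    linarith

/-- The uniform version over a finite family: one `0 < ε ≤ 1/4` for all `h̄ᵢ`. [folklore] -/
theorem exists_eps_family {m : ℕ} (f : Fin m → HandleAttachingMap n k M) (U : Fin m → Set M)
    (hU : ∀ i, IsOpen (U i)) (hcore : ∀ i, (f i).core ⊆ U i) :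
    ∃ ε : ℝ, 0 < ε ∧ ε ≤ 1 / 4 ∧ ∀ (i : Fin m) (y : ↥(handleTube n k)),
      1 - 2 * ε < lamSq k (((y : closedBall (0 : EuclideanSpace ℝ (Fin (n + 1))) 1) :
        EuclideanSpace ℝ (Fin (n + 1)))) → (f i).toFun y ∈ U i := by
  choose e he hle hmem using fun i => exists_lamSq_gt_mem (f i) (hU i) (hcore i)
  rcases Nat.eq_zero_or_pos m with rfl | hm
  · exact ⟨1 / 4, by norm_num, le_rfl, fun i => Fin.elim0 i⟩
  · haveI : Nonempty (Fin m) := ⟨⟨0, hm⟩⟩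
    obtain ⟨i₀, -, hi₀⟩ := Finset.exists_min_image Finset.univ e Finset.univ_nonempty
    refine ⟨e i₀, he i₀, hle i₀, fun i y hy => hmem i y ?_⟩
    have := hi₀ i (Finset.mem_univ i)
    linarith

end Compact

/-! ## §2 Thin data with the same seam -/

section Thin

variable {g n : ℕ} {h : Fin n → HandleAttachingMap 3 2 (Base g)}
  {X : Type} [TopologicalSpace X] [ChartedSpace (EuclideanHalfSpace 4) X] [IsManifold (𝓡∂ 4) ∞ X]

/-- **Thin data with the same seam** (piece (a) of the N1 contract).  For every family of open
sets `U k ⊇ (h k).core` there are attaching maps `h' k` (the shrunken maps `(h k).shrink`) and a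
datum `D'` of the SAME `X` with: thin tubes `range (h' k).toFun ⊆ U k`; the same attaching circles,
handle framings and cores; `D'.jA a' = D.jA a` whenever `a' = a` as points of `Base g`;
`range D'.jA = range D.jA`; and `D'.jB k b = D.jB k b` at every deep point `D'.jB k b ∉ range D'.jA`.
(The new handle embeddings are `LocalityData.jB'`: `D.jB k` near the belt disc, `D.jA ∘ h̄ₖ ∘ α`
elsewhere.) [cite: Kosinski1993, VI §6 with VI §1 (proof of (1.1))] -/
theorem exists_thinData (D : MultiAttachmentData h (𝓡∂ 4) X) (U : Fin n → Set (Base g))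
    (hU : ∀ k, IsOpen (U k)) (hcore : ∀ k, (h k).core ⊆ U k) :
    ∃ (h' : Fin n → HandleAttachingMap 3 2 (Base g)) (D' : MultiAttachmentData h' (𝓡∂ 4) X),
      (∀ k, range (h' k).toFun ⊆ U k) ∧
      (∀ k, (h' k).attachingCircle = (h k).attachingCircle) ∧
      (∀ k, (h' k).attachingFraming = (h k).attachingFraming) ∧
      (∀ k, (h' k).core = (h k).core) ∧
      (∀ (a' : ↥(coresComplement h')) (a : ↥(coresComplement h)), (a' : Base g) = a →
        D'.jA a' = D.jA a) ∧
      range D'.jA = range D.jA ∧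
      (∀ k b, D'.jB k b ∉ range D'.jA → D'.jB k b = D.jB k b) := by
  -- the tube `T ⊆ D⁴` is non-empty (it contains the attaching circle): needed by `shrink`
  haveI : Nonempty ↥(handleTube 3 2) := ⟨coreTubePt (circlePt 0)⟩
  obtain ⟨ε, hε, hε4, hmem⟩ := exists_eps_family h U hU hcore
  have hε2 : 2 * ε ≤ 1 := by linarith
  -- the shrunken family and the locality datum
  set h' : Fin n → HandleAttachingMap 3 2 (Base g) := fun k => (h k).shrink hε hε2 with hh'
  have heq : ∀ (k : Fin n) (y : ↥(handleTube 3 2)),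
      1 - ε < lamSq 2 (((y : closedBall (0 : EuclideanSpace ℝ (Fin 4)) 1) : EuclideanSpace ℝ (Fin 4))) →
      (h k).toFun y = (h' k).toFun y :=
    fun k y hy => ((h k).shrink_apply_of_lt hε hε2 hy).symm
  let L : LocalityData h h' X :=
    { ε := ε, ε_pos := hε, eqOn := heq,
      disjoint := pairwise_disjoint_range_shrink hε hε2 D.disjoint, disjointG := D.disjoint,
      jA := D.jA, jB := D.jB, hjA := D.hjA, hjAo := D.hjAo, hjB := D.hjB, cover := D.cover,
      glue := D.glue, disjointB := D.disjointB }
  have hr : range (L.jA ∘ L.ccCongr) = range D.jA := L.ccCongr.surjective.range_comp _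
  let D' : MultiAttachmentData h' (𝓡∂ 4) X :=
    { disjoint := L.disjoint
      jA := L.jA ∘ L.ccCongr
      jB := L.jB'
      hjA := L.hjA.comp_openPartialHomeomorph L.ccCongr.toHomeomorph.toOpenPartialHomeomorph rfl
        (L.ccCongr.contMDiff.contMDiffOn.congr fun _ _ => rfl)
        (L.ccCongr.symm.contMDiff.contMDiffOn.congr fun _ _ => rfl)
      hjAo := by rw [hr]; exact D.hjAo
      hjB := L.isSmoothEmbedding_jB'
      cover := L.cover'
      glue := L.jA_eq_jB'_iff
      disjointB := L.disjointB' }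
  refine ⟨h', D', fun k => ?_, fun k => ?_, fun k => ?_, fun k => (h k).core_shrink hε hε2, ?_, hr,
    fun k b hb => ?_⟩
  · -- thin tubes
    refine ((h k).range_shrink_subset hε hε2).trans ?_
    rintro _ ⟨y, hy, rfl⟩
    exact hmem k y hy
  · -- same attaching circle
    funext θ
    exact (h k).shrink_apply_of_eq_one hε hε2 (lamSq_corePt θ)
  · -- same handle framing: the maps agree near the attaching sphere
    funext θ
    have hev : (h' k).toFun =ᶠ[𝓝 (coreTubePt θ)] (h k).toFun := by
      have ho : IsOpen {y : ↥(handleTube 3 2) | 1 - ε <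
          lamSq 2 (((y : closedBall (0 : EuclideanSpace ℝ (Fin 4)) 1) : EuclideanSpace ℝ (Fin 4)))} :=
        isOpen_lt continuous_const (continuous_lamSq_handleTube 3 2)
      have hmem0 : coreTubePt θ ∈ {y : ↥(handleTube 3 2) | 1 - ε <
          lamSq 2 (((y : closedBall (0 : EuclideanSpace ℝ (Fin 4)) 1) : EuclideanSpace ℝ (Fin 4)))} := by
        show 1 - ε < lamSq 2 (corePt θ)
        rw [lamSq_corePt]; linarith
      filter_upwards [ho.mem_nhds hmem0] with y hy
      exact (heq k y hy).symm
    show mfderiv (𝓡∂ 4) (𝓡∂ 4) (h' k).toFun (coreTubePt θ) _ =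
      mfderiv (𝓡∂ 4) (𝓡∂ 4) (h k).toFun (coreTubePt θ) _
    rw [hev.mfderiv_eq]
    rfl
  · -- same `jA` on the common complement of the cores
    intro a' a he
    show D.jA (L.ccCongr a') = D.jA a
    congr 1
    exact Subtype.ext he
  · -- deep points of the new handles are the old ones
    by_cases hb0 : lamSq 2 (((b : closedBall (0 : EuclideanSpace ℝ (Fin 4)) 1) : EuclideanSpace ℝ (Fin 4))) = 0
    · exact L.jB'_of_lt k (by rw [hb0]; exact hε)
    · exfalso
      refine hb ?_
      show L.jB' k b ∈ range (L.jA ∘ L.ccCongr)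
      rw [hr, L.jB'_of_ne_zero k hb0]
      exact mem_range_self _

end Thin

end HurwitzMoveModel

open HurwitzMoveModel

/-! ## §3 The registered form -/

/-- **Sub-goal `helper_exists_thinData`** (piece (a) of the N1 contract, fully qualified): thin
tubes with the same seam — see `exists_thinData`.
[cite: Kosinski1993, VI §6 with VI §1 (proof of (1.1))] -/
theorem helper_exists_thinData : ∀ (g n : ℕ) (h : Fin n → Literature.Topology.FourManifolds.HandleAttachingMap 3 2 (Literature.Topology.FourManifolds.LefschetzBase.Base g)) (X : Type) [TopologicalSpace X] [ChartedSpace (EuclideanHalfSpace 4) X] [IsManifold (𝓡∂ 4) ∞ X] (D : Literature.Topology.FourManifolds.HandleAttachingMap.MultiAttachmentData h (𝓡∂ 4) X) (U : Fin n → Set (Literature.Topology.FourManifolds.LefschetzBase.Base g)), (∀ k, IsOpen (U k)) → (∀ k, (h k).core ⊆ U k) → ∃ (h' : Fin n → Literature.Topology.FourManifolds.HandleAttachingMap 3 2 (Literature.Topology.FourManifolds.LefschetzBase.Base g)) (D' : Literature.Topology.FourManifolds.HandleAttachingMap.MultiAttachmentData h' (𝓡∂ 4) X), (∀ k, Set.range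 (h' k).toFun ⊆ U k) ∧ (∀ k, (h' k).attachingCircle = (h k).attachingCircle) ∧ (∀ k, (h' k).attachingFraming = (h k).attachingFraming) ∧ (∀ k, (h' k).core = (h k).core) ∧ (∀ (a' : ↥(Literature.Topology.FourManifolds.HandleAttachingMap.coresComplement h')) (a : ↥(Literature.Topology.FourManifolds.HandleAttachingMap.coresComplement h)), (a' : Literature.Topology.FourManifolds.LefschetzBase.Base g) = a → D'.jA a' = D.jA a) ∧ Set.range D'.jA = Set.range D.jA ∧ (∀ k b, D'.jB k b ∉ Set.range D'.jA → D'.jB k b = D.jB k b) :=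
  fun _ _ _ _ _ _ _ D U hU hcore => exists_thinData D U hU hcore

end Summit.SmoothPoincare4.SmoothPoincare4.Theorems.AcyclicBisectionExists.ModpBraidOrbits

end
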